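import Mathlib

/-!
# HodgeLocusCensusGKHesseAnchors — kernel-checked algebra behind DERIVATION-GK-A §5i (engine A, gen 37)

certified instances and evidence bearing on the general Hodge conjecture; no claim.

Context (programme V3-XT, N = 1 conductor-ℓ row, wild corner ℓ = 3).  The P36 sign law for the
X₀(3)-Hauptmodul unit at level-3 Heegner points was reduced (DERIVATION §5h) to a CM-free local
statement L37 about the quantity `ρ(P,Q) = Δ / (3 (1 + 2 e₃(P,Q)) y(P) y(Q)³)` for a canonical
3-torsion point `P` and a non-canonical one `Q`.  §5i computes `ρ` on the Hesse pencil
`X³ + Y³ + Z³ = 3 μ X Y Z` (the universal curve over `X(3)`), origin `O = [1:-1:0]`, flex tangent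
`T = X + Y + μ Z`, in the monic model
`M_μ : y² = x³ + a₂ x² + a₄ x + a₆`, `a₂ = -3μ²/4`, `a₄ = μ(μ³-1)/6`, `a₆ = -(μ³-1)²/108`.
This file certifies the IDENTITIES used there (pure commutative algebra; `ω` is any element with
`ω² + ω + 1 = 0` of a field of characteristic 0):

* `hesse_to_model` — `T³ · (model equation at x = Z/T, y = X/T) = Hesse cubic` (polynomial identity);
* `modelM_b8`, `modelM_disc` — `b₈ = 0` and `Δ(M_μ) = (μ³-1)³/27`;
* `flexB0_on_M`, `flexB0_three_torsion` — `B₀ = ((μ²+μ+1)/3, (μ²+μ+1)/6)` lies on `M_μ` and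
  `ψ₃(x(B₀)) = 0`;
* `flexA_on_M` — for `6(1-ω) y_A = -ω²(μ³-1)`: `108 y_A² = -(μ³-1)²` (so `A = (0, y_A) ∈ M_μ`,
  and `ψ₃(0) = b₈ = 0`);
* `weil_A_B0`, `tangent_B0` — `e₃(A,B₀) = ω²` in the convention `W(P,Q) = -f_P(Q)/f_Q(P)`
  (tangent lines at the flexes), as `f_A(B₀) + ω² f_{B₀}(A) = 0`; slope at `B₀` is `(μ+2)/2`;
* `six_yA`, `rho_A_B0` — `6(1+2ω²) y_A = μ³-1` and the closed form
  `Δ (μ²+μ+1) = 16 (μ-1)² · 3(1+2ω²) y_A (N/6)³`, i.e. `ρ(A,B₀) = 16(μ-1)²/(μ²+μ+1)`;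
* `rho_minus_sixteen`, `norm_split` — `16(ν-1)² - 16(ν²+ν+1) = -48ν` and `ν²+ν+1 = (ν-1)² + 3ν`
  (the shape `ρ = 16/(1 + 3ν/(ν-1)²)` giving `ρ ≡ 16 ≡ 1` when `v(3ν/(ν-1)²) > 0`);
* `Nk_factor` — `(1 + μω + μ²ω²)(μω - 1) = μ³ - 1`;
* `lucas_twelve` — `C(12,3) ≡ 1 (mod 3)` and `3 ∣ C(12,k)` for `k ∉ {0,3,9,12}` (descent of the
  third elementary symmetric function of the twelve `ρ`'s).

Nothing here is a statement about elliptic curves as Mathlib objects; the dictionary to §5i is in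
the docstrings.  Helper file, computational (`--supports stmt-HodgeConjecture-16267 --as helper`).
-/

set_option linter.dupNamespace false

namespace Summit.HodgeConjecture.HodgeConjecture.HodgeLocus.Census.GKHesseAnchors

section model

variable {R : Type*} [CommRing R]

/-- With `T = X + Y + μZ` (flex tangent at `O = [1:-1:0]`), the functions `x = Z/T`, `y = X/T`
satisfy `3y² + 3μxy - 3y = (μx-1)³ - x³`; cleared of `T³` this is the polynomial identity below
(note `T³((μx-1)³ - x³) = (μZ - T)³ - Z³ = -(X+Y)³ - Z³`). -/
theorem hesse_to_model (X Y Z μ : R) :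
    3 * X ^ 2 * (X + Y + μ * Z) + 3 * μ * X * Z * (X + Y + μ * Z) - 3 * X * (X + Y + μ * Z) ^ 2
      + (X + Y) ^ 3 + Z ^ 3 = X ^ 3 + Y ^ 3 + Z ^ 3 - 3 * μ * X * Y * Z := by
  ring

end model

section field

variable {K : Type*} [Field K]

section charzero

variable [CharZero K]

/-- Coefficients of the monic model `M_μ` (after `y ↦ y + (μx-1)/2` and scaling by
`c₃ = (μ³-1)/3`). -/
def a₂ (μ : K) : K := -3 * μ ^ 2 / 4
/-- see `a₂` -/
def a₄ (μ : K) : K := μ * (μ ^ 3 - 1) / 6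
/-- see `a₂` -/
def a₆ (μ : K) : K := -(μ ^ 3 - 1) ^ 2 / 108

/-- `b₈ = 4a₂a₆ - a₄² = 0` for `M_μ`. -/
theorem modelM_b8 (μ : K) : 4 * a₂ μ * a₆ μ - (a₄ μ) ^ 2 = 0 := by
  unfold a₂ a₄ a₆; ring

/-- `Δ(M_μ) = -b₂²b₈ - 8b₄³ - 27b₆² + 9b₂b₄b₆ = (μ³-1)³/27` with `b₂ = 4a₂, b₄ = 2a₄, b₆ = 4a₆`. -/
theorem modelM_disc (μ : K) :
    -(4 * a₂ μ) ^ 2 * (4 * a₂ μ * a₆ μ - (a₄ μ) ^ 2) - 8 * (2 * a₄ μ) ^ 3 - 27 * (4 * a₆ μ) ^ 2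
      + 9 * (4 * a₂ μ) * (2 * a₄ μ) * (4 * a₆ μ) = (μ ^ 3 - 1) ^ 3 / 27 := by
  unfold a₂ a₄ a₆; ring

/-- The flex `B₀ = [0:1:-1]` maps to `((μ²+μ+1)/3, (μ²+μ+1)/6)`, which lies on `M_μ`. -/
theorem flexB0_on_M (μ : K) :
    ((μ ^ 2 + μ + 1) / 6) ^ 2
      = ((μ ^ 2 + μ + 1) / 3) ^ 3 + a₂ μ * ((μ ^ 2 + μ + 1) / 3) ^ 2
        + a₄ μ * ((μ ^ 2 + μ + 1) / 3) + a₆ μ := by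
  unfold a₂ a₄ a₆; ring

/-- `ψ₃(x) = 3x⁴ + 4a₂x³ + 6a₄x² + 12a₆x + (4a₂a₆ - a₄²)` vanishes at `x(B₀) = (μ²+μ+1)/3`
(so `B₀` is 3-torsion). -/
theorem flexB0_three_torsion (μ : K) :
    3 * ((μ ^ 2 + μ + 1) / 3) ^ 4 + 4 * a₂ μ * ((μ ^ 2 + μ + 1) / 3) ^ 3
      + 6 * a₄ μ * ((μ ^ 2 + μ + 1) / 3) ^ 2 + 12 * a₆ μ * ((μ ^ 2 + μ + 1) / 3)
      + (4 * a₂ μ * a₆ μ - (a₄ μ) ^ 2) = 0 := by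
  unfold a₂ a₄ a₆; ring

end charzero

/-- The flex `A = [1:-ω:0]` maps to `(0, y_A)` with `6(1-ω)y_A = -ω²(μ³-1)`; then
`108 y_A² = -(μ³-1)²`, i.e. `y_A² = a₆` (and `ψ₃(0) = b₈ = 0` by `modelM_b8`), so `A ∈ M_μ[3]`.
Stated as `ω · (108 y_A² + (μ³-1)²) = 0` (`ω ≠ 0` since `ω³ = 1`). -/
theorem flexA_on_M (ω μ yA : K) (hω : ω ^ 2 + ω + 1 = 0)
    (hy : 6 * (1 - ω) * yA = -ω ^ 2 * (μ ^ 3 - 1)) :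
    ω * (108 * yA ^ 2 + (μ ^ 3 - 1) ^ 2) = 0 := by
  linear_combination (-(6 * (1 - ω) * yA - ω ^ 2 * (μ ^ 3 - 1))) * hy
    + (36 * yA ^ 2 - ω * (ω - 1) * (μ ^ 3 - 1) ^ 2) * hω

/-- `6(1+2ω²)·y_A = μ³ - 1` (from `6(1-ω)y_A = -ω²(μ³-1)` and `ω²+ω+1 = 0`). -/
theorem six_yA (ω μ yA : K) (hω : ω ^ 2 + ω + 1 = 0)
    (hy : 6 * (1 - ω) * yA = -ω ^ 2 * (μ ^ 3 - 1)) :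
    6 * (1 + 2 * ω ^ 2) * yA = μ ^ 3 - 1 := by
  linear_combination (-ω) * hy + (6 * yA - (μ ^ 3 - 1) * (1 - ω)) * hω

section charzero2

variable [CharZero K]

/-- Closed form of the registered quantity on the Hesse pencil:
`ρ(A,B₀) := Δ / (3(1+2e₃(A,B₀))·y_A·y_{B₀}³)` with `Δ = (μ³-1)³/27`, `e₃(A,B₀) = ω²`,
`y_{B₀} = (μ²+μ+1)/6` equals `16(μ-1)²/(μ²+μ+1)`; cleared of the denominators:
`Δ·(μ²+μ+1) = 16(μ-1)² · (3(1+2ω²) y_A ((μ²+μ+1)/6)³)`. -/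
theorem rho_A_B0 (ω μ yA : K) (hω : ω ^ 2 + ω + 1 = 0)
    (hy : 6 * (1 - ω) * yA = -ω ^ 2 * (μ ^ 3 - 1)) :
    (μ ^ 3 - 1) ^ 3 / 27 * (μ ^ 2 + μ + 1)
      = 16 * (μ - 1) ^ 2 * (3 * (1 + 2 * ω ^ 2) * yA * ((μ ^ 2 + μ + 1) / 6) ^ 3) := by
  have h := six_yA ω μ yA hω hy
  linear_combination (-(μ - 1) ^ 2 * (μ ^ 2 + μ + 1) ^ 3 / 27) * h

/-- `e₃(A, B₀) = ω²` in the convention `W(P,Q) = -f_P(Q)/f_Q(P)`, where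
`f_P(R) = y_R - y_P - λ_P (x_R - x_P)` is the tangent line at the flex `P`,
`λ_P = (3x_P² + 2a₂x_P + a₄)/(2y_P)`; here `A = (0, y_A)`, `B₀ = (N/3, N/6)`, `N = μ²+μ+1`.
Equivalently `f_A(B₀) + ω²·f_{B₀}(A) = 0` (then `-f_A(B₀)/f_{B₀}(A) = ω²`; `f_{B₀}(A) ≠ 0` is
part of the §5i computation, not certified here). -/
theorem weil_A_B0 (ω μ yA : K) (hω : ω ^ 2 + ω + 1 = 0)
    (hy : 6 * (1 - ω) * yA = -ω ^ 2 * (μ ^ 3 - 1)) (hyA : yA ≠ 0)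
    (hN : μ ^ 2 + μ + 1 ≠ 0) :
    ((μ ^ 2 + μ + 1) / 6 - yA - (a₄ μ / (2 * yA)) * ((μ ^ 2 + μ + 1) / 3 - 0))
      + ω ^ 2 * (yA - (μ ^ 2 + μ + 1) / 6
          - ((3 * ((μ ^ 2 + μ + 1) / 3) ^ 2 + 2 * a₂ μ * ((μ ^ 2 + μ + 1) / 3) + a₄ μ)
              / (2 * ((μ ^ 2 + μ + 1) / 6))) * (0 - (μ ^ 2 + μ + 1) / 3)) = 0 := by
  have h1 : (2 : K) * ((μ ^ 2 + μ + 1) / 6) ≠ 0 :=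
    mul_ne_zero two_ne_zero (div_ne_zero hN (by norm_num))
  have h2 : (2 : K) * yA ≠ 0 := mul_ne_zero two_ne_zero hyA
  unfold a₂ a₄
  grind

/-- The slope of the tangent at `B₀` simplifies to `(μ+2)/2` and `f_{B₀}(A) = y_A + (μ+1)N/6`. -/
theorem tangent_B0 (μ : K) (hN : μ ^ 2 + μ + 1 ≠ 0) :
    (3 * ((μ ^ 2 + μ + 1) / 3) ^ 2 + 2 * a₂ μ * ((μ ^ 2 + μ + 1) / 3) + a₄ μ)
      / (2 * ((μ ^ 2 + μ + 1) / 6)) = (μ + 2) / 2 := by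
  have h1 : (2 : K) * ((μ ^ 2 + μ + 1) / 6) ≠ 0 :=
    mul_ne_zero two_ne_zero (div_ne_zero hN (by norm_num))
  unfold a₂ a₄
  grind

end charzero2

/-- `ρ = 16(ν-1)²/(ν²+ν+1)` differs from `16` by `-48ν/(ν²+ν+1)`: numerator identity. -/
theorem rho_minus_sixteen (ν : K) :
    16 * (ν - 1) ^ 2 - 16 * (ν ^ 2 + ν + 1) = -48 * ν := by ring

/-- `ν² + ν + 1 = (ν-1)² + 3ν`, so `ρ = 16 / (1 + 3ν/(ν-1)²)`. -/
theorem norm_split (ν : K) : ν ^ 2 + ν + 1 = (ν - 1) ^ 2 + 3 * ν := by ring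

/-- `N₁ · (μω - 1) = μ³ - 1` for `N₁ = 1 + μω + μ²ω²` (`ω³ = 1`). -/
theorem Nk_factor (ω μ : K) (hω : ω ^ 2 + ω + 1 = 0) :
    (1 + μ * ω + μ ^ 2 * ω ^ 2) * (μ * ω - 1) = μ ^ 3 - 1 := by
  linear_combination (μ ^ 3 * (ω - 1)) * hω

end field

/-- Lucas at `p = 3`, `n = 12 = (110)₃`: `C(12,3) ≡ 1 (mod 3)` and `3 ∣ C(12,k)` unless
`k ∈ {0,3,9,12}` — the third elementary symmetric function of twelve quantities each `≡ ε (mod 𝔓)`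
is `≡ C(12,3)ε³ = ε`. -/
theorem lucas_twelve :
    Nat.choose 12 3 % 3 = 1 ∧ ∀ k ∈ Finset.range 13, k ∉ ({0, 3, 9, 12} : Finset ℕ) →
      3 ∣ Nat.choose 12 k := by
  decide

end Summit.HodgeConjecture.HodgeConjecture.HodgeLocus.Census.GKHesseAnchors
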